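import Summits.CriticalPhenomena.PercolationContinuityZ3.Theses.PercNonProliferation
import Literature.Barriers.CriticalPhenomena.GaussianDominationRoute

/-!
# `FreeBoxSparse` (crux stmt-CriticalPhenomena-4445): irrefutability certificate and the bulk twin

Negative-side analysis (cdisprove, refuter-cdisprove-stmt-CriticalPhenomena-4445-0), all PROVED:

* `tendsto_pairAverage_of_tendsto_cofinite` — Cesàro over pairs of the box `B(n) ⊆ ℤ³`;
* `tendsto_freePairAverage_of_theta_eq_zero` — `θ(p) = 0` IMPLIES the crux's statement at `p`
  (`P(x ↔ y in B(n)) ≤ τ_p(0, y - x) → 0` cofinitely iff `θ(p) = 0`, tree: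
  `theta_eq_zero_iff_tendsto_tau_cofinite`), hence
  `theta_pos_of_not_freeBoxSparse` / `not_percolationContinuityZ3_of_not_freeBoxSparse` — a
  refutation of the crux would be a proof of the jump `θ(p_c(ℤ³)) > 0`, i.e. a refutation of the
  summit conjunct `PercolationContinuityZ3` itself;
* `tendsto_bulkPairAverage_iff_theta_eq_zero` — the BULK twin of the crux (`P(x ↔ y)` in place of
  `P(x ↔ y inside B(n))`) is EQUIVALENT to `θ(p) = 0` at every `p` (`θ² ≤ τ`, uniqueness + FKG, tree:
  `Grimmett1999_theta_sq_le_openConn_holds`): the only load-bearing feature of the crux relative to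
  the summit is the restriction "inside `B(n)`".
-/

namespace Summit.CriticalPhenomena.PercolationContinuityZ3.Theorems.FreeBoxSparse.Negative

open MeasureTheory Filter Topology
open Literature.Probability.Percolation Literature.Probability.LatticeModels
open Literature.Barriers.CriticalPhenomena (theta_eq_zero_iff_tendsto_tau_cofinite)
open Summit.CriticalPhenomena.PercolationContinuityZ3.Theses.PercNonProliferation (FreeBoxSparse)

/-- `n + 1 ≤ |B(n)| = (2n+1)³`. [folklore] -/
theorem succ_le_card_box (n : ℕ) : (n : ℝ) + 1 ≤ (box 3 n).card := by
  rw [card_box]; push_cast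
  nlinarith [sq_nonneg (n : ℝ), (Nat.cast_nonneg n : (0 : ℝ) ≤ n)]

/-- **Cesàro over pairs.** If `0 ≤ g_n(x,y) ≤ min(1, f(y-x))` and `f → 0` at infinity (cofinitely on
`ℤ³`), then `|B(n)|⁻² Σ_{x,y∈B(n)} g_n(x,y) → 0`: for `ε > 0` only finitely many `z`, say `K`, have
`f z ≥ ε/2`, and each row `x` contributes at most `K + |B(n)| ε/2`. [folklore] -/
theorem tendsto_pairAverage_of_tendsto_cofinite {f : Site 3 → ℝ} (hf : Tendsto f cofinite (𝓝 0))
    {g : ℕ → Site 3 → Site 3 → ℝ} (hg0 : ∀ n x y, 0 ≤ g n x y) (hg1 : ∀ n x y, g n x y ≤ 1)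
    (hgf : ∀ n x y, g n x y ≤ f (y - x)) :
    Tendsto (fun n : ℕ => (∑ x ∈ box 3 n, ∑ y ∈ box 3 n, g n x y) / ((box 3 n).card : ℝ) ^ 2)
      atTop (𝓝 0) := by
  rw [Metric.tendsto_atTop]
  intro ε hε
  have hε2 : (0 : ℝ) < ε / 2 := by linarith
  have hT : {z : Site 3 | ¬ f z < ε / 2}.Finite :=
    Filter.eventually_cofinite.1 (hf.eventually (gt_mem_nhds hε2))
  set T : Finset (Site 3) := hT.toFinset with hTdef
  set K : ℕ := T.card with hKdef
  obtain ⟨N, hN⟩ : ∃ N : ℕ, (2 * K / ε : ℝ) < N := exists_nat_gt _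
  refine ⟨N, fun n hn => ?_⟩
  have hcard : (0 : ℝ) < (box 3 n).card := by exact_mod_cast Finset.card_pos.2 (box_nonempty 3 n)
  have hrow : ∀ x : Site 3, ∑ y ∈ box 3 n, g n x y ≤ K + (box 3 n).card * (ε / 2) := by
    intro x
    rw [← Finset.sum_filter_add_sum_filter_not (box 3 n) (fun y => y - x ∈ T)]
    refine add_le_add ?_ ?_
    · calc ∑ y ∈ (box 3 n).filter (fun y => y - x ∈ T), g n x y
          ≤ ∑ y ∈ (box 3 n).filter (fun y => y - x ∈ T), (1 : ℝ) :=
            Finset.sum_le_sum fun y _ => hg1 n x y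
        _ = (((box 3 n).filter (fun y => y - x ∈ T)).card : ℝ) := by simp
        _ ≤ K := by
            have h : ((box 3 n).filter (fun y => y - x ∈ T)).card ≤ T.card :=
              Finset.card_le_card_of_injOn (fun y => y - x)
                (fun y hy => Finset.mem_coe.2 (Finset.mem_filter.1 (Finset.mem_coe.1 hy)).2)
                (fun a _ b _ hab => sub_left_injective hab)
            exact_mod_cast h
    · calc ∑ y ∈ (box 3 n).filter (fun y => ¬ (y - x ∈ T)), g n x y
          ≤ ∑ y ∈ (box 3 n).filter (fun y => ¬ (y - x ∈ T)), ε / 2 := by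
            refine Finset.sum_le_sum fun y hy => ?_
            have hyT : y - x ∉ T := (Finset.mem_filter.1 hy).2
            have hlt : f (y - x) < ε / 2 := by
              by_contra h
              exact hyT (hT.mem_toFinset.2 h)
            exact (hgf n x y).trans hlt.le
        _ = (((box 3 n).filter (fun y => ¬ (y - x ∈ T))).card : ℝ) * (ε / 2) := by
            rw [Finset.sum_const, nsmul_eq_mul]
        _ ≤ (box 3 n).card * (ε / 2) :=
            mul_le_mul_of_nonneg_right (by exact_mod_cast Finset.card_filter_le _ _) hε2.le
  have htot : ∑ x ∈ box 3 n, ∑ y ∈ box 3 n, g n x y ≤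
      (box 3 n).card * (K + (box 3 n).card * (ε / 2)) := by
    calc ∑ x ∈ box 3 n, ∑ y ∈ box 3 n, g n x y ≤ ∑ _x ∈ box 3 n, (K + (box 3 n).card * (ε / 2)) :=
          Finset.sum_le_sum fun x _ => hrow x
      _ = _ := by rw [Finset.sum_const, nsmul_eq_mul]
  have hnn : 0 ≤ ∑ x ∈ box 3 n, ∑ y ∈ box 3 n, g n x y :=
    Finset.sum_nonneg fun x _ => Finset.sum_nonneg fun y _ => hg0 n x y
  rw [Real.dist_eq, sub_zero, abs_of_nonneg (div_nonneg hnn (sq_nonneg _)),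
    div_lt_iff₀ (by positivity)]
  have hK : (K : ℝ) < (box 3 n).card * (ε / 2) := by
    have h1 : (K : ℝ) < N * (ε / 2) := by
      rw [div_lt_iff₀ hε] at hN; linarith
    have h2 : (N : ℝ) ≤ n := by exact_mod_cast hn
    have h3 : (n : ℝ) ≤ (box 3 n).card := by linarith [succ_le_card_box n]
    calc (K : ℝ) < N * (ε / 2) := h1
      _ ≤ n * (ε / 2) := by gcongr
      _ ≤ (box 3 n).card * (ε / 2) := by gcongr
  calc ∑ x ∈ box 3 n, ∑ y ∈ box 3 n, g n x y
      ≤ (box 3 n).card * (K + (box 3 n).card * (ε / 2)) := htot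
    _ < (box 3 n).card * ((box 3 n).card * (ε / 2) + (box 3 n).card * (ε / 2)) := by gcongr
    _ = ε * ((box 3 n).card : ℝ) ^ 2 := by ring

/-- **`θ(p) = 0 ⇒` the free-box pair average tends to `0` at `p`** (every `p`). [folklore] -/
theorem tendsto_freePairAverage_of_theta_eq_zero (p : unitInterval)
    (hθ : theta (zdGraph 3) (0 : Site 3) p = 0) :
    Tendsto (fun n : ℕ => (∑ x ∈ box 3 n, ∑ y ∈ box 3 n,
        (bondPercolation (zdGraph 3) p).real (openConnIn ↑(box 3 n) x y)) /
          ((box 3 n).card : ℝ) ^ 2) atTop (𝓝 0) := by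
  refine tendsto_pairAverage_of_tendsto_cofinite ((theta_eq_zero_iff_tendsto_tau_cofinite p).1 hθ)
    (g := fun n x y => (bondPercolation (zdGraph 3) p).real (openConnIn ↑(box 3 n) x y))
    (fun _ _ _ => measureReal_nonneg) (fun _ _ _ => measureReal_le_one) fun n x y => ?_
  rw [← tau_eq_tau_zero_sub, tau_def]
  exact measureReal_mono fun ω hω => DCT16.reachable_of_pathIn (DCT16.pathIn_of_mem_openConnIn hω)

/-- **Irrefutability certificate**: `¬ FreeBoxSparse` would prove the jump `θ(p_c(ℤ³)) > 0`
(the summit conjunct `θ(p_c) = 0` implies the crux, by `tendsto_freePairAverage_of_theta_eq_zero`).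
[folklore] -/
theorem theta_pos_of_not_freeBoxSparse (h : ¬ FreeBoxSparse) :
    0 < theta (zdGraph 3) (0 : Site 3) (criticalProbI 3) :=
  lt_of_le_of_ne measureReal_nonneg fun h0 =>
    h (tendsto_freePairAverage_of_theta_eq_zero (criticalProbI 3) h0.symm)

/-- `¬ FreeBoxSparse → ¬ PercolationContinuityZ3`: refuting the crux refutes the summit conjunct.
[folklore] -/
theorem not_percolationContinuityZ3_of_not_freeBoxSparse (h : ¬ FreeBoxSparse) :
    ¬ _root_.PercolationContinuityZ3 := fun hc =>
  h (tendsto_freePairAverage_of_theta_eq_zero (criticalProbI 3) hc)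

/-- Below `p_c` the analogue of the crux holds. [folklore] -/
theorem tendsto_freePairAverage_of_lt_criticalProb (p : unitInterval)
    (hp : (p : ℝ) < criticalProb (zdGraph 3) (0 : Site 3)) :
    Tendsto (fun n : ℕ => (∑ x ∈ box 3 n, ∑ y ∈ box 3 n,
        (bondPercolation (zdGraph 3) p).real (openConnIn ↑(box 3 n) x y)) /
          ((box 3 n).card : ℝ) ^ 2) atTop (𝓝 0) :=
  tendsto_freePairAverage_of_theta_eq_zero p (theta_eq_zero_of_lt_criticalProb_holds (zdGraph 3) 0 p hp)

/-! ### The bulk twin is the summit -/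

/-- `θ(p)²` is below every bulk pair average. [folklore] -/
theorem theta_sq_le_bulkPairAverage (p : unitInterval) (n : ℕ) :
    theta (zdGraph 3) 0 p ^ 2 ≤
      (∑ x ∈ box 3 n, ∑ y ∈ box 3 n, tau 3 p x y) / ((box 3 n).card : ℝ) ^ 2 := by
  have hcard : (0 : ℝ) < (box 3 n).card := by exact_mod_cast Finset.card_pos.2 (box_nonempty 3 n)
  rw [le_div_iff₀ (by positivity)]
  calc theta (zdGraph 3) 0 p ^ 2 * ((box 3 n).card : ℝ) ^ 2
      = ∑ _x ∈ box 3 n, ∑ _y ∈ box 3 n, theta (zdGraph 3) 0 p ^ 2 := by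
        rw [Finset.sum_const, Finset.sum_const, nsmul_eq_mul, nsmul_eq_mul]; ring
    _ ≤ ∑ x ∈ box 3 n, ∑ y ∈ box 3 n, tau 3 p x y :=
        Finset.sum_le_sum fun x _ => Finset.sum_le_sum fun y _ =>
          Grimmett1999_theta_sq_le_openConn_holds 3 p x y

/-- **Bulk pair sparsity ⇔ `θ(p) = 0`** (every `p`): with `τ_p(x,y) = P_p(x ↔ y)` in place of
`P_p(x ↔ y in B(n))` the crux's statement is equivalent to the absence of percolation. [folklore] -/
theorem tendsto_bulkPairAverage_iff_theta_eq_zero (p : unitInterval) :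
    Tendsto (fun n : ℕ => (∑ x ∈ box 3 n, ∑ y ∈ box 3 n, tau 3 p x y) / ((box 3 n).card : ℝ) ^ 2)
        atTop (𝓝 0) ↔ theta (zdGraph 3) 0 p = 0 := by
  constructor
  · intro h
    have h2 : theta (zdGraph 3) 0 p ^ 2 ≤ 0 :=
      ge_of_tendsto h (Eventually.of_forall fun n => theta_sq_le_bulkPairAverage p n)
    exact pow_eq_zero_iff two_ne_zero |>.1 (le_antisymm h2 (sq_nonneg _))
  · intro hθ
    exact tendsto_pairAverage_of_tendsto_cofinite ((theta_eq_zero_iff_tendsto_tau_cofinite p).1 hθ)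
      (g := fun _ x y => tau 3 p x y) (fun _ _ _ => tau_nonneg p _ _) (fun _ _ _ => tau_le_one p _ _)
      (fun _ x y => (tau_eq_tau_zero_sub p x y).le)

/-- At `p_c`: the bulk twin of the crux is EQUIVALENT to the summit conjunct. [folklore] -/
theorem tendsto_bulkPairAverage_criticalProbI_iff :
    Tendsto (fun n : ℕ => (∑ x ∈ box 3 n, ∑ y ∈ box 3 n, tau 3 (criticalProbI 3) x y) /
        ((box 3 n).card : ℝ) ^ 2) atTop (𝓝 0) ↔ _root_.PercolationContinuityZ3 :=
  tendsto_bulkPairAverage_iff_theta_eq_zero _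

end Summit.CriticalPhenomena.PercolationContinuityZ3.Theorems.FreeBoxSparse.Negative
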